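import Literature.Analysis.FluidPDE.TypeIAncientMild
import Literature.Analysis.FluidPDE.AxisymmetricHeatFlow
import HarnessLib

/-!
# `SymmetricLiouville` (crux stmt-NavierStokesRegularity-4053), line `blowdown-kills-pitch`:
# stub `stub_rotationCovariance` — the Type I ancient mild class is rotation covariant

For every linear isometry `L` of a finite-dimensional real inner product space `E` and every
`u ∈ A_C = IsTypeIAncientMild C` (jointly smooth on `(-∞,0) × E`, divergence-free slices, the
Oseen integral equation `u(t) = e^{(t-s)Δ}u(s) - B¹_s(u,u)(t)` between all `s < t < 0`, and the
Type I bound `‖u(t,x)‖ ≤ C/√(-t)`), the conjugated field `(t, x) ↦ L (u t (L⁻¹ x))` lies in `A_C`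
(same constant):

* joint smoothness: composition with the continuous linear equivalences `L`, `(t, x) ↦ (t, L⁻¹x)`;
* divergence: `D(L v L⁻¹)(x) = L ∘ Dv(L⁻¹x) ∘ L⁻¹` and the trace is conjugation invariant;
* the Oseen identity: the heat kernel is radial (`heatExtension_comp_linearIsometryEquiv`,
  `heatExtension_continuousLinearEquiv_comp`), and the Oseen–Koch–Tataru kernel, built from inner
  products and radial Gaussian weights, is `O(E)`-equivariant,
  `K(τ, Lz)[La, Lb] = L K(τ, z)[a, b]` (`oseenKernel_map_linearIsometryEquiv`), whence
  `B^ν_s(LuL⁻¹, LvL⁻¹)(t)(x) = L B^ν_s(u, v)(t)(L⁻¹x)` by the measure-preserving substitution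
  `y = L y'` (`oseenDuhamel_conj_linearIsometryEquiv`);
* the Type I bound: `‖L v‖ = ‖v‖`.

The generic statement is `isTypeIAncientMild_conj_linearIsometryEquiv`; the registered stub
`stub_rotationCovariance` is its specialisation to `ℝ³`.
-/

noncomputable section

set_option linter.dupNamespace false

open MeasureTheory Set Function
open scoped RealInnerProductSpace
open Literature.Analysis Literature.Analysis.FluidPDE

namespace Summit.NavierStokesRegularity.NavierStokesRegularity.Theorems.SymmetryModuliCountSymmetricLiouville

/-- Local notation for physical space `ℝ³`. -/
local notation "E3" => EuclideanSpace ℝ (Fin 3)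

section General

-- adapted from Cruxes/HelicalEndLiouville/Disproof.lean (§ "Rotation covariance of the Oseen class")

variable {E : Type*} [NormedAddCommGroup E] [InnerProductSpace ℝ E] [FiniteDimensional ℝ E]
  [MeasurableSpace E] [BorelSpace E]

omit [FiniteDimensional ℝ E] [MeasurableSpace E] [BorelSpace E] in
/-- The heat kernel is radial, hence invariant under a linear isometry:
`G_t(L z) = G_t(z)`. [folklore] -/
theorem heatKernel_map_linearIsometryEquiv (L : E ≃ₗᵢ[ℝ] E) (t : ℝ) (z : E) :
    UnboundedOperators.heatKernel t (L z) = UnboundedOperators.heatKernel t z := by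
  rw [UnboundedOperators.heatKernel_eq, UnboundedOperators.heatKernel_eq, L.norm_map]

omit [FiniteDimensional ℝ E] [MeasurableSpace E] [BorelSpace E] in
/-- The first Gaussian weight of the Oseen kernel is radial: `A(τ, L z) = A(τ, z)`. [folklore] -/
theorem oseenWeightA_map_linearIsometryEquiv (L : E ≃ₗᵢ[ℝ] E) (τ : ℝ) (z : E) :
    oseenWeightA τ (L z) = oseenWeightA τ z := by
  simp only [oseenWeightA, heatKernel_map_linearIsometryEquiv]

omit [FiniteDimensional ℝ E] [MeasurableSpace E] [BorelSpace E] in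
/-- The second Gaussian weight of the Oseen kernel is radial: `B(τ, L z) = B(τ, z)`. [folklore] -/
theorem oseenWeightB_map_linearIsometryEquiv (L : E ≃ₗᵢ[ℝ] E) (τ : ℝ) (z : E) :
    oseenWeightB τ (L z) = oseenWeightB τ z := by
  simp only [oseenWeightB, heatKernel_map_linearIsometryEquiv]

omit [FiniteDimensional ℝ E] [MeasurableSpace E] [BorelSpace E] in
/-- **The Oseen–Koch–Tataru kernel is equivariant under linear isometries**:
`K(τ, L z)[L a, L b] = L (K(τ, z)[a, b])` — its closed form is built from inner products, the
radial heat kernel and the radial Gaussian weights. [folklore] -/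
theorem oseenKernel_map_linearIsometryEquiv (L : E ≃ₗᵢ[ℝ] E) (τ : ℝ) (z a b : E) :
    oseenKernel τ (L z) (L a) (L b) = L (oseenKernel τ z a b) := by
  simp only [oseenKernel, LinearIsometryEquiv.inner_map_map, heatKernel_map_linearIsometryEquiv,
    oseenWeightA_map_linearIsometryEquiv, oseenWeightB_map_linearIsometryEquiv, map_add, map_sub,
    LinearIsometryEquiv.map_smul]

omit [FiniteDimensional ℝ E] [MeasurableSpace E] [BorelSpace E] in
/-- A linear isometric equivalence commutes with the Bochner integral (no integrability
hypothesis is needed for an equivalence). [folklore] -/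
theorem integral_linearIsometryEquiv_comm {X : Type*} [MeasurableSpace X] (μ : Measure X)
    (L : E ≃ₗᵢ[ℝ] E) (f : X → E) : ∫ x, L (f x) ∂μ = L (∫ x, f x ∂μ) :=
  L.toContinuousLinearEquiv.integral_comp_comm f

/-- **The Oseen–Duhamel term is covariant under linear isometries**:
`B^ν_s(L u L⁻¹, L v L⁻¹)(t)(x) = L (B^ν_s(u, v)(t)(L⁻¹ x))` (substitute `y = L y'` in the space
integral, `L` preserving Lebesgue measure, and use the equivariance of the kernel). [folklore] -/
theorem oseenDuhamel_conj_linearIsometryEquiv (L : E ≃ₗᵢ[ℝ] E) (ν s : ℝ) (u v : ℝ → E → E)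
    (t : ℝ) (x : E) :
    oseenDuhamel ν s (fun τ y => L (u τ (L.symm y))) (fun τ y => L (v τ (L.symm y))) t x =
      L (oseenDuhamel ν s u v t (L.symm x)) := by
  simp only [oseenDuhamel_apply]
  rw [← integral_linearIsometryEquiv_comm]
  refine setIntegral_congr_fun measurableSet_Ioo fun τ _ => ?_
  rw [← integral_linearIsometryEquiv_comm]
  have hmp : MeasurePreserving L volume volume := L.measurePreserving
  rw [← hmp.integral_comp L.toHomeomorph.measurableEmbedding
    (fun y => oseenKernel (ν * (t - τ)) (x - y) (L (u τ (L.symm y))) (L (v τ (L.symm y))))]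
  congr 1
  funext y
  have e : x - L y = L (L.symm x - y) := by simp [map_sub]
  simp only [LinearIsometryEquiv.symm_apply_apply]
  rw [e, oseenKernel_map_linearIsometryEquiv]

/-- **The heat flow is covariant under linear isometries**:
`e^{σΔ}(L φ L⁻¹)(x) = L (e^{σΔ}φ)(L⁻¹ x)` for every `σ` (for `σ ≤ 0` both sides are the data). [folklore] -/
theorem heatFlow_conj_linearIsometryEquiv (L : E ≃ₗᵢ[ℝ] E) (φ : E → E) (σ : ℝ) (x : E) :
    heatFlow (fun y => L (φ (L.symm y))) σ x = L (heatFlow φ σ (L.symm x)) := by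
  rcases le_or_gt σ 0 with h | h
  · simp [heatFlow_of_nonpos _ h]
  · rw [heatFlow_of_pos _ h, heatFlow_of_pos _ h,
      heatExtension_comp_linearIsometryEquiv L.symm (fun z => L (φ z)) σ x]
    have e : (fun z => L (φ z)) = fun z => L.toContinuousLinearEquiv (φ z) := rfl
    rw [e, heatExtension_continuousLinearEquiv_comp]
    rfl

omit [FiniteDimensional ℝ E] [MeasurableSpace E] [BorelSpace E] in
/-- The divergence is invariant under conjugation by a linear isometry:
`div (L φ L⁻¹)(x) = div φ (L⁻¹ x)` for differentiable `φ` (chain rule and `tr (L A L⁻¹) = tr A`). [folklore] -/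
theorem divergence_conj_linearIsometryEquiv' (L : E ≃ₗᵢ[ℝ] E) {φ : E → E}
    (hd : Differentiable ℝ φ) (x : E) :
    VectorCalculus.divergence (fun y => L (φ (L.symm y))) x =
      VectorCalculus.divergence φ (L.symm x) := by
  unfold VectorCalculus.divergence
  have hA : HasFDerivAt (fun y : E => L.symm y) (L.symm.toContinuousLinearEquiv : E →L[ℝ] E) x :=
    L.symm.toContinuousLinearEquiv.hasFDerivAt
  have hB : HasFDerivAt φ (fderiv ℝ φ (L.symm x)) (L.symm x) := (hd _).hasFDerivAt
  have hC : HasFDerivAt (fun z : E => L z) (L.toContinuousLinearEquiv : E →L[ℝ] E)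
      (φ (L.symm x)) :=
    L.toContinuousLinearEquiv.hasFDerivAt
  have hcomp : HasFDerivAt (fun y => L (φ (L.symm y)))
      ((L.toContinuousLinearEquiv : E →L[ℝ] E).comp ((fderiv ℝ φ (L.symm x)).comp
        (L.symm.toContinuousLinearEquiv : E →L[ℝ] E))) x :=
    (hC.comp (L.symm x) hB).comp x hA
  rw [hcomp.fderiv]
  have key : ((L.toContinuousLinearEquiv : E →L[ℝ] E).comp ((fderiv ℝ φ (L.symm x)).comp
      (L.symm.toContinuousLinearEquiv : E →L[ℝ] E)) : E →ₗ[ℝ] E) =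
      L.toLinearEquiv.conj (fderiv ℝ φ (L.symm x) : E →ₗ[ℝ] E) := by
    ext v
    simp [LinearEquiv.conj_apply]
  rw [key, LinearMap.trace_conj']

omit [FiniteDimensional ℝ E] [MeasurableSpace E] [BorelSpace E] in
/-- A divergence-free differentiable field stays divergence free under conjugation by a linear
isometry. [folklore] -/
theorem isDivFree_conj_linearIsometryEquiv (L : E ≃ₗᵢ[ℝ] E) {φ : E → E}
    (hφ : VectorCalculus.IsDivFree φ) (hd : Differentiable ℝ φ) :
    VectorCalculus.IsDivFree (fun y => L (φ (L.symm y))) := by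
  intro x
  rw [divergence_conj_linearIsometryEquiv' L hd x]
  exact hφ _

/-- **`A_C` is invariant under linear isometries** (generic inner product space):
`IsTypeIAncientMild C u → IsTypeIAncientMild C ((t, x) ↦ L (u t (L⁻¹ x)))`, with the same
constant. [folklore] -/
theorem isTypeIAncientMild_conj_linearIsometryEquiv {C : ℝ} {u : ℝ → E → E}
    (h : IsTypeIAncientMild C u) (L : E ≃ₗᵢ[ℝ] E) :
    IsTypeIAncientMild C (fun t x => L (u t (L.symm x))) := by
  refine ⟨?_, fun t ht => ?_, fun s t hst ht x => ?_, fun t ht x => ?_⟩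
  · -- joint smoothness
    have e : uncurry (fun t x => L (u t (L.symm x))) =
        (fun z : E => L.toContinuousLinearEquiv z) ∘ uncurry u ∘
          fun p : ℝ × E => (p.1, L.symm.toContinuousLinearEquiv p.2) := by
      funext p; rfl
    rw [e]
    refine L.toContinuousLinearEquiv.contDiff.comp_contDiffOn (h.contDiffOn.comp ?_ ?_)
    · exact (contDiff_fst.prodMk
        (L.symm.toContinuousLinearEquiv.contDiff.comp contDiff_snd)).contDiffOn
    · intro p hp
      exact ⟨hp.1, mem_univ _⟩
  · -- divergence free
    have hd : Differentiable ℝ (u t) := (h.contDiff_slice ht).differentiable (by simp)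
    exact isDivFree_conj_linearIsometryEquiv L (h.isDivFree ht) hd
  · -- the Oseen identity
    show L (u t (L.symm x)) = heatFlow (fun y => L (u s (L.symm y))) (t - s) x -
        oseenDuhamel 1 s (fun τ y => L (u τ (L.symm y))) (fun τ y => L (u τ (L.symm y))) t x
    rw [oseenDuhamel_conj_linearIsometryEquiv, heatFlow_conj_linearIsometryEquiv,
      h.mild_eq hst ht (L.symm x), map_sub]
  · -- Type I
    show ‖L (u t (L.symm x))‖ ≤ C / Real.sqrt (-t)
    rw [LinearIsometryEquiv.norm_map]
    exact h.norm_le ht _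

end General

/-- **Stub 2' — rotation covariance of `A_C` on `ℝ³`**: for every linear isometry `L` of `ℝ³`,
`u ∈ A_C` implies `(t, x) ↦ L (u t (L⁻¹ x)) ∈ A_C` (isometry-equivariance of the heat kernel and
of `oseenKernel`, trace invariance of the divergence, `‖L v‖ = ‖v‖`). [folklore] -/
theorem stub_rotationCovariance :
    ∀ (C : ℝ) (L : E3 ≃ₗᵢ[ℝ] E3) (u : ℝ → E3 → E3), IsTypeIAncientMild C u →
      IsTypeIAncientMild C (fun t x => L (u t (L.symm x))) :=
  fun _ L _ hu => isTypeIAncientMild_conj_linearIsometryEquiv hu L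

end Summit.NavierStokesRegularity.NavierStokesRegularity.Theorems.SymmetryModuliCountSymmetricLiouville

end
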